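import Summits.QuantumFields.QCD.Theses.SpectralDefectExtinction
import Literature.MathematicalPhysics.QuantumFieldTheory.QCDPhaseQuenched
import Literature.MathematicalPhysics.QuantumFieldTheory.SpectralDefectDensity
import Literature.Barriers.QuantumFields.WilsonDeterminantMassSplitting
import Summits.QuantumFields.QCD.Theorems.SpectralDefectExtinctionWegnerEstimateReduction
import Summits.QuantumFields.QCD.Theorems.SpectralDefectExtinctionWegnerEstimateStubSchurComplement
import Summits.QuantumFields.QCD.Theorems.SpectralDefectExtinctionWegnerEstimateStubRecentreGeometry
import Summits.QuantumFields.QCD.Theorems.SpectralDefectExtinctionWegnerEstimateStubDiracLocality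
import Summits.QuantumFields.QCD.Theorems.SpectralDefectExtinctionWegnerEstimateStubRecentreDirac
import Summits.QuantumFields.QCD.Theorems.SpectralDefectExtinctionWegnerEstimateStubHaarTransport
import Summits.QuantumFields.QCD.Theorems.SpectralDefectExtinctionWegnerEstimateStubSigmaTraceContinuous

/-!
# EXTERIOR ELIMINATION for crux `SpectralDefectExtinction.WegnerEstimate` (item stmt-QuantumFields-8966)

Line `Sketch` (skeleton "ResolventCell", reshaped gen 1), lead prover-line-stmt-QuantumFields-8966-c1-0.  This file lands the
sorry-free part of the reshaped skeleton as CONDITIONAL theorems: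

* `exteriorElimination` — on a torus `L ≥ 2R+4`, the local resolvent trace at `x` of the Hermitian Wilson–Dirac operator of a
  configuration glued from an arbitrary exterior `U` and cell links `V` (cube `x + box 4 R`) equals, for every `V`, the local
  trace at the centre of the `(2R+3)`-torus of the pulled-back configuration, DRESSED by one dissipative self-energy `S`
  (`i(Sᴴ − S) ≥ 0`) supported off the cube and chosen before `V` (Feshbach–Schur self-energy of the far exterior, recentred,
  plus the Hermitian seam correction).  Assembled from the landed stubs `stub_schurComplement` (p117653),
  `stub_recentreGeometry` (p118072), `stub_diracLocality` (p118370), `stub_recentreDirac` (p118975).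
* `localHaarWegner_of_cellWegner` — the old open stub `stub_localHaarWegner` (β-free, `L`-free local Haar–Wegner lemma with
  frozen exterior; hypothesis of the landed `wegnerEstimate_of_localHaarWegner`, p91808) FOLLOWS from the cell lemma
  `CellWegner` (stated verbatim as the hypothesis): a FIXED FINITE-DIMENSIONAL family for each `R` — tori `2 ≤ L ≤ 2R+3`,
  exterior `U`, dissipative collar self-energy `S`.  Uses in addition `stub_haarTransport` (p119072) and
  `stub_sigmaTraceContinuous` (p119335).
* `wegnerEstimate_of_cellWegner` — hence the crux follows from the cell lemma.

So after this file the crux `WegnerEstimate` is kernel-reduced to the single open stub `stub_cellWegner` of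
`Cruxes/WegnerEstimate/Lines/Sketch.lean` (known FALSE at `R = 1` by the star-vertex cancellation p94448; open at `R ≥ 2`).

Sources: Feshbach–Schur / Krein resolvent formula (folklore; e.g. Aizenman–Warzel, *Random Operators*, GSM 168 (2015),
§5.4 "Schur complement"); the recentring is bookkeeping.
-/

noncomputable section

namespace Summit.QuantumFields.QCD.Cruxes.WegnerEstimate.ResolventCell

open MeasureTheory
open scoped Matrix BigOperators
open Literature.MathematicalPhysics.QuantumLattice Literature.MathematicalPhysics.QuantumFieldTheory
  Literature.Probability.LatticeModels
open Summit.QuantumFields.QCD.Theses.SpectralDefectExtinction (WegnerEstimate)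
open Literature.Barriers.QuantumFields (isHermitian_gammaFive_mul_wilsonDirac)
open Matrix
open scoped ComplexOrder

/-! ## Exterior elimination -/

/-- **Exterior elimination** (assembled from `stub_schurComplement`, `stub_recentreGeometry`, `stub_diracLocality`,
`stub_recentreDirac`): on a torus `L ≥ 2R+4`, the local trace at `x` of the glued configuration equals, for every
cell configuration `V`, the `S`-dressed local trace at the centre of the `(2R+3)`-torus of the pulled-back
configuration, for ONE dissipative, collar-supported `S` (Schur self-energy of the far exterior, recentred, plus the
seam correction) chosen before `V`. -/
theorem exteriorElimination (R : ℕ) (L : ℕ) [NeZero L] [NeZero (2 * R + 3)] (hL : 2 * R + 4 ≤ L)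
    (x : TorusSite 4 L) (U : GaugeConfig 4 L SU3) (m₀ ε : ℝ) (hε : 0 < ε) :
    ∃ (S : Matrix (QuarkIdx (2 * R + 3)) (QuarkIdx (2 * R + 3)) ℂ),
      (∀ p q : QuarkIdx (2 * R + 3), ((∃ y ∈ box 4 R, p.1 = 0 + Torus.proj (2 * R + 3) y) ∨
          (∃ y ∈ box 4 R, q.1 = 0 + Torus.proj (2 * R + 3) y)) → S p q = 0) ∧
      (Complex.I • (Sᴴ - S)).PosSemidef ∧
      ∀ V : GaugeConfig 4 L SU3,
        (∑ a : Fin 3, ∑ α : Fin 4,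
          (((spinorLift gammaFive * wilsonDirac (fundamentalRep (Fin 3))
              (fun e => if (∃ y ∈ box 4 R, e.1 = x + Torus.proj L y) then V e else U e) m₀ 1 -
            ((ε : ℂ) * Complex.I) • (1 : Matrix (QuarkIdx L) (QuarkIdx L) ℂ))⁻¹ :
              Matrix (QuarkIdx L) (QuarkIdx L) ℂ) (x, a, α) (x, a, α)).im) =
        (∑ a : Fin 3, ∑ α : Fin 4,
          (((spinorLift gammaFive * wilsonDirac (fundamentalRep (Fin 3))
              (fun e => if (∃ y ∈ box 4 R, e.1 = 0 + Torus.proj (2 * R + 3) y) then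
                  V (x + Torus.proj L (fun i => ((e.1 i).valMinAbs : ℤ)), e.2)
                else U (x + Torus.proj L (fun i => ((e.1 i).valMinAbs : ℤ)), e.2)) m₀ 1 -
            ((ε : ℂ) * Complex.I) • (1 : Matrix (QuarkIdx (2 * R + 3)) (QuarkIdx (2 * R + 3)) ℂ) - S)⁻¹ :
              Matrix (QuarkIdx (2 * R + 3)) (QuarkIdx (2 * R + 3)) ℂ)
              ((0 : TorusSite 4 (2 * R + 3)), a, α) ((0 : TorusSite 4 (2 * R + 3)), a, α)).im) := by
  classical
  -- notation
  have hρ : ∀ g, fundamentalRep (Fin 3) g ∈ Matrix.unitaryGroup (Fin 3) ℂ := fundamentalRep_mem_unitaryGroup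
  set σ : TorusSite 4 (2 * R + 3) → TorusSite 4 L :=
    fun s => x + Torus.proj L (fun i => ((s i).valMinAbs : ℤ)) with hσ
  set glue : GaugeConfig 4 L SU3 → GaugeConfig 4 L SU3 :=
    fun V e => if (∃ y ∈ box 4 R, e.1 = x + Torus.proj L y) then V e else U e with hglue
  set H : GaugeConfig 4 L SU3 → Matrix (QuarkIdx L) (QuarkIdx L) ℂ :=
    fun W => spinorLift gammaFive * wilsonDirac (fundamentalRep (Fin 3)) W m₀ 1 with hH
  have hHerm : ∀ W, (H W).IsHermitian := fun W => isHermitian_gammaFive_mul_wilsonDirac _ hρ W m₀ 1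
  -- the four structural stubs
  obtain ⟨hinj, hrange, hcube, hσ0⟩ := stub_recentreGeometry R (2 * R + 3) rfl L hL x
  obtain ⟨hloc, hext⟩ := stub_diracLocality R L x U m₀
  obtain ⟨Θ, hΘh, hΘs, hΘ⟩ := stub_recentreDirac R (2 * R + 3) rfl L hL x U
  -- the cell predicate (radius-(R+1) cube) and the exterior blocks, read off at `V := U`
  let P : QuarkIdx L → Prop := fun q => ∃ y ∈ box 4 (R + 1), q.1 = x + Torus.proj L y
  let B : Matrix {q // P q} {q // ¬ P q} ℂ := fun i k => H (glue U) i.1 k.1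
  let D : Matrix {q // ¬ P q} {q // ¬ P q} ℂ := fun k l => H (glue U) k.1 l.1
  have hDh : D.IsHermitian := by
    refine Matrix.IsHermitian.ext fun k l => ?_
    exact (hHerm (glue U)).apply k.1 l.1
  obtain ⟨S, hSd, hSrow, hScol, hSchur⟩ := stub_schurComplement P ε hε B D hDh
  -- the recentring equivalence `κ : QuarkIdx (2R+3) ≃ {q // P q}`
  let f : QuarkIdx (2 * R + 3) → {q // P q} :=
    fun q₀ => ⟨(σ q₀.1, q₀.2), (hrange _).2 ⟨q₀.1, rfl⟩⟩
  have hfinj : Function.Injective f := by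
    intro a b hab
    have h1 : (σ a.1, a.2) = (σ b.1, b.2) := congrArg Subtype.val hab
    obtain ⟨h1a, h1b⟩ := Prod.mk.inj h1
    exact Prod.ext (hinj h1a) h1b
  have hfsurj : Function.Surjective f := by
    rintro ⟨q, hq⟩
    obtain ⟨s₀, hs₀⟩ := (hrange q.1).1 hq
    refine ⟨(s₀, q.2), Subtype.ext ?_⟩
    change (σ s₀, q.2) = q
    exact Prod.ext hs₀ rfl
  let κ : QuarkIdx (2 * R + 3) ≃ {q // P q} := Equiv.ofBijective f ⟨hfinj, hfsurj⟩
  have hκ : ∀ q₀ : QuarkIdx (2 * R + 3), ((κ q₀ : {q // P q}) : QuarkIdx L) = (σ q₀.1, q₀.2) := fun q₀ => rfl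
  -- the final self-energy on the small torus
  refine ⟨S.submatrix κ κ + Θ, ?_, ?_, ?_⟩
  · -- support: off the cube in both indices
    intro p q hpq
    have hΘ0 : Θ p q = 0 := hΘs p q hpq
    have hS0 : S (κ p) (κ q) = 0 := by
      rcases hpq with hp | hq
      · -- row `κ p` of `B` vanishes: `σ p.1` lies in the cube `x + box R`
        have hp' : ∃ y ∈ box 4 R, σ p.1 = x + Torus.proj L y := (hcube p.1).2 hp
        refine hSrow _ _ fun k => ?_
        change H (glue U) (σ p.1, p.2) k.1 = 0
        exact (hloc (glue U) (σ p.1, p.2) k.1 hp' k.2).1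
      · have hq' : ∃ y ∈ box 4 R, σ q.1 = x + Torus.proj L y := (hcube q.1).2 hq
        refine hScol _ _ fun k => ?_
        change H (glue U) (σ q.1, q.2) k.1 = 0
        exact (hloc (glue U) (σ q.1, q.2) k.1 hq' k.2).1
    simp [Matrix.add_apply, Matrix.submatrix_apply, hΘ0, hS0]
  · -- dissipativity survives recentring and the Hermitian seam correction
    have hΘc : Θᴴ = Θ := hΘh
    have : Complex.I • ((S.submatrix κ κ + Θ)ᴴ - (S.submatrix κ κ + Θ)) =
        (Complex.I • (Sᴴ - S)).submatrix κ κ := by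
      rw [Matrix.conjTranspose_add, hΘc, Matrix.conjTranspose_submatrix]
      ext a b
      simp [Matrix.sub_apply, Matrix.smul_apply, Matrix.submatrix_apply]
    rw [this]
    exact hSd.submatrix κ
  · -- the pointwise identity
    intro V
    -- Schur on the `L`-torus for `M := H (glue V)` (its exterior blocks are those of `glue U`)
    have hB : ∀ (i : {q // P q}) (k : {q // ¬ P q}), H (glue V) i.1 k.1 = B i k :=
      fun i k => (hext V U i.1 k.1 k.2).1
    have hD : ∀ (k l : {q // ¬ P q}), H (glue V) k.1 l.1 = D k l :=
      fun k l => (hext V U k.1 l.1 l.2).1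
    have hS := hSchur (H (glue V)) (hHerm (glue V)) hB hD
    -- recentred Dirac matrix: the cell block read through `κ` is the small-torus matrix minus `Θ`
    set W₀ : GaugeConfig 4 (2 * R + 3) SU3 := fun e => glue V (σ e.1, e.2) with hW₀
    set H₀ : Matrix (QuarkIdx (2 * R + 3)) (QuarkIdx (2 * R + 3)) ℂ :=
      spinorLift gammaFive * wilsonDirac (fundamentalRep (Fin 3)) W₀ m₀ 1 with hH₀
    have hblock : ((H (glue V)).submatrix Subtype.val Subtype.val -
        ((ε : ℂ) * Complex.I) • (1 : Matrix {q // P q} {q // P q} ℂ) - S).submatrix κ κ =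
        H₀ - ((ε : ℂ) * Complex.I) • (1 : Matrix (QuarkIdx (2 * R + 3)) (QuarkIdx (2 * R + 3)) ℂ) -
          (S.submatrix κ κ + Θ) := by
      ext a b
      have hM : H (glue V) (σ a.1, a.2) (σ b.1, b.2) = (H₀ - Θ) a b := hΘ V m₀ a b
      have h1 : (1 : Matrix {q // P q} {q // P q} ℂ) (κ a) (κ b) =
          (1 : Matrix (QuarkIdx (2 * R + 3)) (QuarkIdx (2 * R + 3)) ℂ) a b := by
        simp only [Matrix.one_apply, EmbeddingLike.apply_eq_iff_eq]
      simp only [Matrix.submatrix_apply, Matrix.sub_apply, Matrix.add_apply, Matrix.smul_apply, hκ, hM, h1]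
      ring
    -- the glued configuration read through the recentring is the small-torus glue
    have hW₀' : W₀ = fun e : Edge 4 (2 * R + 3) =>
        if (∃ y ∈ box 4 R, e.1 = 0 + Torus.proj (2 * R + 3) y) then
          V (x + Torus.proj L (fun i => ((e.1 i).valMinAbs : ℤ)), e.2)
        else U (x + Torus.proj L (fun i => ((e.1 i).valMinAbs : ℤ)), e.2) := by
      funext e
      simp only [hW₀, hglue, hσ]
      by_cases h : ∃ y ∈ box 4 R, e.1 = 0 + Torus.proj (2 * R + 3) y
      · rw [if_pos h, if_pos ((hcube e.1).2 h)]
      · rw [if_neg h, if_neg (fun h' => h ((hcube e.1).1 h'))]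
    -- assemble, entry by entry
    refine Finset.sum_congr rfl fun a _ => Finset.sum_congr rfl fun α _ => ?_
    have hxa : ((x, a, α) : QuarkIdx L) = ((κ ((0 : TorusSite 4 (2 * R + 3)), a, α) : {q // P q}) : QuarkIdx L) := by
      rw [hκ]
      exact Prod.ext hσ0.symm rfl
    have step1 : ((H (glue V) - ((ε : ℂ) * Complex.I) • (1 : Matrix (QuarkIdx L) (QuarkIdx L) ℂ))⁻¹ :
          Matrix (QuarkIdx L) (QuarkIdx L) ℂ) (x, a, α) (x, a, α) =
        (((H (glue V)).submatrix Subtype.val Subtype.val -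
          ((ε : ℂ) * Complex.I) • (1 : Matrix {q // P q} {q // P q} ℂ) - S)⁻¹ : Matrix {q // P q} {q // P q} ℂ)
          (κ ((0 : TorusSite 4 (2 * R + 3)), a, α)) (κ ((0 : TorusSite 4 (2 * R + 3)), a, α)) := by
      rw [hxa]
      exact hS _ _
    have step2 : (((H (glue V)).submatrix Subtype.val Subtype.val -
          ((ε : ℂ) * Complex.I) • (1 : Matrix {q // P q} {q // P q} ℂ) - S)⁻¹ : Matrix {q // P q} {q // P q} ℂ)
          (κ ((0 : TorusSite 4 (2 * R + 3)), a, α)) (κ ((0 : TorusSite 4 (2 * R + 3)), a, α)) =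
        (H₀ - ((ε : ℂ) * Complex.I) • (1 : Matrix (QuarkIdx (2 * R + 3)) (QuarkIdx (2 * R + 3)) ℂ) -
          (S.submatrix κ κ + Θ))⁻¹
          ((0 : TorusSite 4 (2 * R + 3)), a, α) ((0 : TorusSite 4 (2 * R + 3)), a, α) := by
      rw [← hblock, Matrix.inv_submatrix_equiv]
      rfl
    change ((H (glue V) - ((ε : ℂ) * Complex.I) • (1 : Matrix (QuarkIdx L) (QuarkIdx L) ℂ))⁻¹
        (x, a, α) (x, a, α)).im = _
    rw [step1, step2, hH₀, hW₀']

/-- **The old local Haar–Wegner lemma follows from the cell lemma.**  Hypothesis `hcellWegner` = verbatim the statement of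
the open stub `stub_cellWegner` of line `Sketch`; conclusion = verbatim the statement of the old stub `stub_localHaarWegner`
(hypothesis of the landed `wegnerEstimate_of_localHaarWegner`).  Small tori `L ≤ 2R+3`: the cell lemma with `S = 0`; large tori:
`exteriorElimination`, `stub_haarTransport` (`integral_map`), `stub_sigmaTraceContinuous` (measurability), and the cell lemma on
the `(2R+3)`-torus at the centre. -/
theorem localHaarWegner_of_cellWegner
    (hcellWegner : ∃ R : ℕ, ∃ C : ℝ, 0 < C ∧ ∀ (L : ℕ) [NeZero L], 2 ≤ L → L ≤ 2 * R + 3 →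
      ∀ (x : TorusSite 4 L) (m₀ ε : ℝ), -1 ≤ m₀ → m₀ ≤ 0 → 0 < ε → ε ≤ 1 →
      ∀ (U : GaugeConfig 4 L SU3) (S : Matrix (QuarkIdx L) (QuarkIdx L) ℂ),
        (∀ p q : QuarkIdx L, ((∃ y ∈ box 4 R, p.1 = x + Torus.proj L y) ∨
            (∃ y ∈ box 4 R, q.1 = x + Torus.proj L y)) → S p q = 0) →
        (Complex.I • (Sᴴ - S)).PosSemidef →
        ∫ V, (∑ a : Fin 3, ∑ α : Fin 4,
          (((spinorLift gammaFive * wilsonDirac (fundamentalRep (Fin 3))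
              (fun e => if (∃ y ∈ box 4 R, e.1 = x + Torus.proj L y) then V e else U e) m₀ 1 -
            ((ε : ℂ) * Complex.I) • (1 : Matrix (QuarkIdx L) (QuarkIdx L) ℂ) - S)⁻¹ :
              Matrix (QuarkIdx L) (QuarkIdx L) ℂ) (x, a, α) (x, a, α)).im)
          ∂(Measure.pi fun _ : Edge 4 L => haarProbability SU3) ≤ C) :
    ∃ R : ℕ, ∃ C : ℝ, 0 < C ∧ ∀ (L : ℕ) [NeZero L], 2 ≤ L →
      ∀ (x : TorusSite 4 L) (m₀ ε : ℝ), -1 ≤ m₀ → m₀ ≤ 0 → 0 < ε → ε ≤ 1 →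
      ∀ U : GaugeConfig 4 L SU3,
        ∫ V, (∑ a : Fin 3, ∑ α : Fin 4,
          (((spinorLift gammaFive * wilsonDirac (fundamentalRep (Fin 3))
              (fun e => if (∃ y ∈ box 4 R, e.1 = x + Torus.proj L y) then V e else U e) m₀ 1 -
            ((ε : ℂ) * Complex.I) • (1 : Matrix (QuarkIdx L) (QuarkIdx L) ℂ))⁻¹ :
              Matrix (QuarkIdx L) (QuarkIdx L) ℂ) (x, a, α) (x, a, α)).im)
          ∂(Measure.pi fun _ : Edge 4 L => haarProbability SU3) ≤ C := by
  classical
  obtain ⟨R, C, hC, hcell⟩ := hcellWegner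
  refine ⟨R, C, hC, ?_⟩
  intro L _ hL2 x m₀ ε hm hm' hε hε1 U
  by_cases hsmall : L ≤ 2 * R + 3
  · -- small torus: the cell lemma with `S = 0`
    have h := hcell L hL2 hsmall x m₀ ε hm hm' hε hε1 U 0 (fun _ _ _ => rfl)
      (by simpa using Matrix.PosSemidef.zero)
    simpa only [sub_zero] using h
  · -- large torus: exterior elimination, recentring, transport
    have hL : 2 * R + 4 ≤ L := by omega
    haveI : NeZero (2 * R + 3) := ⟨by omega⟩
    obtain ⟨S, hSs, hSd, hpt⟩ := exteriorElimination R L hL x U m₀ ε hε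
    obtain ⟨hinj, -, -, -⟩ := stub_recentreGeometry R (2 * R + 3) rfl L hL x
    -- the recentring of edges and its injectivity
    set ι : Edge 4 (2 * R + 3) → Edge 4 L :=
      fun e => (x + Torus.proj L (fun i => ((e.1 i).valMinAbs : ℤ)), e.2) with hι
    have hιinj : Function.Injective ι := by
      intro a b hab
      obtain ⟨h1, h2⟩ := Prod.mk.inj hab
      exact Prod.ext (hinj h1) h2
    -- the dressed local trace on the small torus, as a function of the small-torus cell configuration
    set U₀ : GaugeConfig 4 (2 * R + 3) SU3 := U ∘ ι with hU₀
    set F : GaugeConfig 4 (2 * R + 3) SU3 → ℝ := fun V₀ => ∑ a : Fin 3, ∑ α : Fin 4,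
      (((spinorLift gammaFive * wilsonDirac (fundamentalRep (Fin 3))
          (fun e => if (∃ y ∈ box 4 R, e.1 = 0 + Torus.proj (2 * R + 3) y) then V₀ e else U₀ e) m₀ 1 -
        ((ε : ℂ) * Complex.I) • (1 : Matrix (QuarkIdx (2 * R + 3)) (QuarkIdx (2 * R + 3)) ℂ) - S)⁻¹ :
          Matrix (QuarkIdx (2 * R + 3)) (QuarkIdx (2 * R + 3)) ℂ)
          ((0 : TorusSite 4 (2 * R + 3)), a, α) ((0 : TorusSite 4 (2 * R + 3)), a, α)).im with hF
    have hFcont : Continuous F :=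
      stub_sigmaTraceContinuous (2 * R + 3) R 0 U₀ S hSd m₀ ε hε
    -- pointwise: the integrand is `F (V ∘ ι)`
    have hptF : ∀ V : GaugeConfig 4 L SU3,
        (∑ a : Fin 3, ∑ α : Fin 4,
          (((spinorLift gammaFive * wilsonDirac (fundamentalRep (Fin 3))
              (fun e => if (∃ y ∈ box 4 R, e.1 = x + Torus.proj L y) then V e else U e) m₀ 1 -
            ((ε : ℂ) * Complex.I) • (1 : Matrix (QuarkIdx L) (QuarkIdx L) ℂ))⁻¹ :
              Matrix (QuarkIdx L) (QuarkIdx L) ℂ) (x, a, α) (x, a, α)).im) = F (V ∘ ι) := by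
      intro V
      rw [hpt V]
      rfl
    -- transport of product Haar
    have hmp := stub_haarTransport (haarProbability SU3) ι hιinj
    have hmap : ∫ V, F (V ∘ ι) ∂(Measure.pi fun _ : Edge 4 L => haarProbability SU3) =
        ∫ V₀, F V₀ ∂(Measure.pi fun _ : Edge 4 (2 * R + 3) => haarProbability SU3) := by
      have hae : AEStronglyMeasurable F
          (Measure.map (fun V : GaugeConfig 4 L SU3 => V ∘ ι)
            (Measure.pi fun _ : Edge 4 L => haarProbability SU3)) := by
        rw [hmp.map_eq]
        exact hFcont.aestronglyMeasurable
      rw [← integral_map hmp.measurable.aemeasurable hae, hmp.map_eq]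
    -- the cell lemma on the small torus at the centre
    have hbd := hcell (2 * R + 3) (by omega) le_rfl (0 : TorusSite 4 (2 * R + 3)) m₀ ε hm hm' hε hε1 U₀ S
      hSs hSd
    calc ∫ V, (∑ a : Fin 3, ∑ α : Fin 4,
          (((spinorLift gammaFive * wilsonDirac (fundamentalRep (Fin 3))
              (fun e => if (∃ y ∈ box 4 R, e.1 = x + Torus.proj L y) then V e else U e) m₀ 1 -
            ((ε : ℂ) * Complex.I) • (1 : Matrix (QuarkIdx L) (QuarkIdx L) ℂ))⁻¹ :
              Matrix (QuarkIdx L) (QuarkIdx L) ℂ) (x, a, α) (x, a, α)).im)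
          ∂(Measure.pi fun _ : Edge 4 L => haarProbability SU3)
        = ∫ V, F (V ∘ ι) ∂(Measure.pi fun _ : Edge 4 L => haarProbability SU3) :=
          integral_congr_ae (Filter.Eventually.of_forall hptF)
      _ = ∫ V₀, F V₀ ∂(Measure.pi fun _ : Edge 4 (2 * R + 3) => haarProbability SU3) := hmap
      _ ≤ C := hbd

/-- **The crux follows from the cell lemma**: `WegnerEstimate` from the statement of `stub_cellWegner` (hypothesis, verbatim),
via `localHaarWegner_of_cellWegner` and the landed resolvent–cell reduction `wegnerEstimate_of_localHaarWegner` (p91808). -/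
theorem wegnerEstimate_of_cellWegner
    (hcellWegner : ∃ R : ℕ, ∃ C : ℝ, 0 < C ∧ ∀ (L : ℕ) [NeZero L], 2 ≤ L → L ≤ 2 * R + 3 →
      ∀ (x : TorusSite 4 L) (m₀ ε : ℝ), -1 ≤ m₀ → m₀ ≤ 0 → 0 < ε → ε ≤ 1 →
      ∀ (U : GaugeConfig 4 L SU3) (S : Matrix (QuarkIdx L) (QuarkIdx L) ℂ),
        (∀ p q : QuarkIdx L, ((∃ y ∈ box 4 R, p.1 = x + Torus.proj L y) ∨
            (∃ y ∈ box 4 R, q.1 = x + Torus.proj L y)) → S p q = 0) →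
        (Complex.I • (Sᴴ - S)).PosSemidef →
        ∫ V, (∑ a : Fin 3, ∑ α : Fin 4,
          (((spinorLift gammaFive * wilsonDirac (fundamentalRep (Fin 3))
              (fun e => if (∃ y ∈ box 4 R, e.1 = x + Torus.proj L y) then V e else U e) m₀ 1 -
            ((ε : ℂ) * Complex.I) • (1 : Matrix (QuarkIdx L) (QuarkIdx L) ℂ) - S)⁻¹ :
              Matrix (QuarkIdx L) (QuarkIdx L) ℂ) (x, a, α) (x, a, α)).im)
          ∂(Measure.pi fun _ : Edge 4 L => haarProbability SU3) ≤ C) :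
    WegnerEstimate :=
  wegnerEstimate_of_localHaarWegner (localHaarWegner_of_cellWegner hcellWegner)

end Summit.QuantumFields.QCD.Cruxes.WegnerEstimate.ResolventCell

end
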